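import Literature.NumberTheory.IwasawaTheory.ClassicalMuVanishesCyclicAscentOddRelative
import Literature.NumberTheory.IwasawaTheory.ClassicalMuVanishesQuadraticAscentShift
import Literature.NumberTheory.NumberFields.SplitPrimesBaseChange
import Literature.NumberTheory.EllipticCurves.ZpExtensionRestrictShift
import HarnessLib

/-!
# Iwasawa's odd-`ℓ` ascent along a cyclic degree-`p` step `K'/K`, per layer, with NO hypothesis on `K ∩ ℚ_∞`, `K' ∩ K_∞`
# (Iwasawa 1973 Thm. 2 at odd `ℓ`, the per-layer bound behind the proviso-free ascent; proved, no definition, no named fact)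

`Proofs`-style file (theorems only, no `sorry`) in topic `NumberTheory/IwasawaTheory` (namespace `Literature.NumberTheory.IwasawaTheory`),
written by the prover seat `bsd-line-att-p3` g36 (cell `bsd-f1-sign2`; LIBRARY PASS — the odd-`p` twin of this seat's
`ClassicalMuVanishesQuadraticAscentShift` (`p = 2`); closes nothing; nothing about elliptic curves or BSD is asserted).

Cell bsd-potss's odd ascents (`ClassicalMuVanishesCyclicAscentOdd{,Rat,Relative}`, `…PExtensionAscentOdd`) live in the RESTRICTED currency:
`κ` the cyclotomic `ℤ_p`-extension of `ℚ`, `κ ∘ res` onto for `K` and `K'` (`K' ∩ ℚ_∞ = ℚ`) — a proviso that FAILS for `p`-extensions through the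
first layer `ℚ_1` (e.g. `ℚ(ζ_{p²})`, `ℚ_n` itself).  Iwasawa's Theorem 2/3 has no such proviso.  As for `p = 2`, the cure is the SHIFTED base
change of cell bsd-2adic (`exists_zpExtension_shift`: `p^a κ₁ = κ ∘ res`, `κ₁` cyclotomic, `κ₁.layer m ≃+* j(K)·ℚ_{m+a}`): take for the base
`K` the cyclotomic `ℤ_p`-extension `κ₁` obtained by shifting `κ` (its layers `K_m ⊆ K̄` are number fields with boundedly many primes above each
rational prime), and for a Galois `K'/K` of degree `p` look at the layer pair `A_m = K_m ⊆ B_m = j''(K')·K_m ⊆ K̄` for EVERY `m`: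
`B_m/A_m` is Galois (tree) and its group embeds into `Gal(K'/K) ≅ C_p` by restriction, so `[B_m : A_m] ∈ {1, p}`; degree `1`: `B_m = A_m`;
degree `p`: Chevalley at odd `p` + the `(σ−1)`-filtration (modules (L), (G) of cells bsd-2adic / bsd-potss) with the ramified primes of `A_m`
lying over the prime factors of `disc K'` (relative base change of unramifiedness), at most `[K:ℚ]·(q^{p−1}−1)(p−1)` of them over each `q`.

* §1 `padicValNat_card_quotient_le_of_cyclic_odd` — pure number fields: `A ⊆ B` Galois of odd prime degree `p`, `≤ T` ramified primes ⟹
  `rank_p Cl(B) ≤ p·(2·rank_p Cl(A) + T)`.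
* §2 `ncard_primesOver_layer_shift_le_odd` — `#{𝔮 ∣ q in K_m} ≤ [K:ℚ]·(q^{p−1}−1)(p−1)` for the layers of a shifted cyclotomic `κ₁` of `K`.
* §3 ★★ **`padicValNat_card_quotient_fieldRange_sup_layer_le_odd`** — the per-layer bound
  `rank_p Cl(j''(K')·K_m) ≤ p·(2·rank_p Cl(K_m) + [K:ℚ]·∑_{q ∣ disc K'} (q^{p−1}−1)(p−1))` for EVERY `m`, no surjectivity anywhere.
The assembled proviso-free ascents (`K'/K` Galois of degree `p^m`; every finite Galois `p`-power extension of `ℚ`) are the sequel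
`ClassicalMuVanishesPExtensionAscentOddFull`.

References: [Iwasawa1973MuInvariants] Thm. 2 (ℓ odd), Thm. 3, §2; [Washington1997] §13.1 (layers `M·ℚ_{n+a}`; finitely many primes above each
prime), §13.3 Prop. 13.23; [Lang1990] Ch. 13 §4 Lemma 4.1–4.2; [NeukirchANT1999] Ch. I §9 Prop. (9.6), Ch. III §2 Cor. (2.12); [Marcus2018] Ch. 4 Thm. 31.
-/

set_option autoImplicit false

noncomputable section

open scoped NumberField Classical
open NumberField Field IntermediateField IsDedekindDomain Module

namespace Literature.NumberTheory.IwasawaTheory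

open Literature.NumberTheory.EllipticCurves Literature.NumberTheory.EllipticCurves.ZpExtension
  Literature.NumberTheory.GaloisRepresentations Literature.NumberTheory.NumberFields
  Literature.NumberTheory.NumberFields.AmbiguousClass Literature.NumberTheory.NumberFields.CyclicRankBound

variable {p : ℕ} [hp : Fact p.Prime]

/-! ## §1 The per-field `p`-rank bound along a cyclic extension of odd prime degree -/

/-- `#(G / Gⁿ) = #(H / Hⁿ)` along a group isomorphism `G ≃* H`. [folklore] -/
private theorem natCard_quotient_range_powMonoidHom_eq_of_mulEquiv₅ {G H : Type*} [CommGroup G] [CommGroup H] (e : G ≃* H) (n : ℕ) :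
    Nat.card (G ⧸ (powMonoidHom n : G →* G).range) = Nat.card (H ⧸ (powMonoidHom n : H →* H).range) := by
  have hmap : ((powMonoidHom n : G →* G).range).map e.toMonoidHom = (powMonoidHom n : H →* H).range := by
    ext h
    constructor
    · rintro ⟨g, ⟨x, rfl⟩, rfl⟩
      exact ⟨e x, by rw [powMonoidHom_apply, powMonoidHom_apply, MulEquiv.coe_toMonoidHom, map_pow]⟩
    · rintro ⟨y, rfl⟩
      refine ⟨(e.symm y) ^ n, ⟨e.symm y, rfl⟩, ?_⟩
      rw [MulEquiv.coe_toMonoidHom, map_pow, MulEquiv.apply_symm_apply, powMonoidHom_apply]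
  exact Nat.card_congr (QuotientGroup.congr _ _ e hmap).toEquiv

/-- **The `p`-rank bound along a Galois extension of odd prime degree `p`** (Chevalley at odd `p`, no archimedean term, + the ambiguous-class rank
lemma): `A ⊆ B` number fields, `B/A` Galois of degree `p`, at most `T` primes of `A` ramified in `B` ⟹ `rank_p Cl(B) ≤ p·(2·rank_p Cl(A) + T)`.
Assembled exactly as inside bsd-potss's `classGroupPRank_restrict_le_of_isGalois_of_finrank_eq_of_odd`, for bare fields.
[cite: Iwasawa1973MuInvariants, Thm. 2 and its proof (§2)] [cite: Lang1990, Ch. 13 §4 Lemma 4.1–4.2] [cite: NeukirchANT1999, Ch. III §1 Prop. (1.6) (ii), (iv)] -/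
theorem padicValNat_card_quotient_le_of_cyclic_odd (hodd : p ≠ 2) (A B : Type) [Field A] [NumberField A] [Field B] [NumberField B]
    [Algebra A B] [IsGalois A B] (hdeg : Module.finrank A B = p) (T : ℕ)
    (hram : {v : HeightOneSpectrum (𝓞 A) | v.asIdeal.ramificationIdxIn (𝓞 B) ≠ 1}.ncard ≤ T) :
    padicValNat p (Nat.card (ClassGroup (𝓞 B) ⧸ (powMonoidHom p : ClassGroup (𝓞 B) →* _).range)) ≤
      p * (2 * padicValNat p (Nat.card (ClassGroup (𝓞 A) ⧸ (powMonoidHom p : ClassGroup (𝓞 A) →* _).range)) + T) := by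
  have hpr : p.Prime := hp.out
  haveI : FiniteDimensional A B := Module.finite_of_finrank_pos (by rw [hdeg]; exact hpr.pos)
  have hcard : Nat.card (B ≃ₐ[A] B) = p := by rw [IsGalois.card_aut_eq_finrank, hdeg]
  haveI : IsCyclic (B ≃ₐ[A] B) := isCyclic_of_prime_card hcard
  obtain ⟨σ, hσ⟩ := IsCyclic.exists_generator (α := B ≃ₐ[A] B)
  have hσp : σ ^ p = 1 := by rw [← hcard]; exact pow_card_eq_one'
  -- Chevalley for odd `p`
  have hchev := padicValNat_card_fixed_add_one_le_of_odd (K := A) (L := B) hpr hodd hdeg hσ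
  -- the action on `Cl(B)` and its fixed classes
  set f : ClassGroup (𝓞 B) ≃* ClassGroup (𝓞 B) := ClassGroup.mulEquiv (intAut σ) with hf
  have hfixed : Nat.card {c : ClassGroup (𝓞 B) // ∀ τ : B ≃ₐ[A] B, ClassGroup.mulEquiv (intAut τ) c = c} =
      Nat.card (f.toMonoidHom.eqLocus (MonoidHom.id _)) :=
    natCard_fixed_eq_natCard_eqLocus_of_generator (fun τ : B ≃ₐ[A] B ↦ ClassGroup.mulEquiv (intAut τ))
      mulEquiv_intAut_one mulEquiv_intAut_mul hσ
  have hff : ∀ b : ClassGroup (𝓞 B), (⇑f.toMonoidHom)^[p] b = b := fun b ↦ by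
    rw [hf, iterate_mulEquiv_intAut_eq_pow, hσp, mulEquiv_intAut_one, MulEquiv.refl_apply]
  -- module (G): the rank bound
  have hNj : ∀ a : ClassGroup (𝓞 A), classGroupNorm A B (classGroupExtend A B a) = a ^ p := fun a ↦ by
    rw [classGroupNorm_classGroupExtend, hdeg]
  have hjfix : ∀ a : ClassGroup (𝓞 A), f.toMonoidHom (classGroupExtend A B a) = classGroupExtend A B a := fun a ↦ by
    rw [MulEquiv.coe_toMonoidHom, hf, mulEquiv_intAut_classGroupExtend]
  have hfix : padicValNat p (Nat.card (f.toMonoidHom.eqLocus (MonoidHom.id _))) ≤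
      padicValNat p (Nat.card (ClassGroup (𝓞 A))) + T := by
    rw [← hfixed]
    have hcl : classNumber A = Nat.card (ClassGroup (𝓞 A)) := by
      rw [classNumber, Nat.card_eq_fintype_card]
    rw [← hcl]
    omega
  exact padicValNat_card_quotient_le_of_fixed p f.toMonoidHom hff (classGroupExtend A B) (classGroupNorm A B) hNj hjfix T hfix

/-! ## §2 Finite decomposition in a shifted cyclotomic `ℤ_p`-tower of `K` -/

/-- **`K_m` has at most `[K:ℚ]·(q^{p−1} − 1)(p − 1)` primes above the rational prime `q`, uniformly in `m`**, for the layers `K_m` of a `ℤ_p`-extension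
`κ₁` of `K` obtained by shifting a cyclotomic `κ` of `ℚ` (`p` odd, `p^a κ₁ = κ ∘ res`; NO hypothesis on `K ∩ ℚ_∞`): `K_m ≅ j(K)·ℚ_{m+a} ⊇ ℚ_{m+a}` with
`[j(K)·ℚ_{m+a} : ℚ_{m+a}] ≤ [K:ℚ]`, and `ℚ_{m+a}` has at most `(q^{p−1}−1)(p−1)` primes above `q` (`ncard_primesOver_layer_le_odd`).
[cite: Washington1997, §13.1 (finitely many primes of `K_∞` above each prime; the layers `M·ℚ_{n+a}`)] -/
theorem ncard_primesOver_layer_shift_le_odd (hodd : p ≠ 2) {κ : ZpExtension ℚ p} (hκ : κ.IsCyclotomic)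
    (K : Type) [Field K] [NumberField K] (κ₁ : ZpExtension K p) {a : ℕ}
    (hs : ∀ σ : absoluteGaloisGroup K, (p : ℤ_[p]) ^ a * (κ₁ σ).toAdd = (κ (absGaloisRestrict ℚ K σ)).toAdd)
    (m : ℕ) {q : ℕ} (hq : q.Prime) :
    (haveI : FiniteDimensional K ↥(κ₁.layer m) := κ₁.finiteDimensional_layer_holds m
     haveI : NumberField ↥(κ₁.layer m) := NumberField.of_module_finite K _
     ((Ideal.span {(q : ℤ)}).primesOver (𝓞 ↥(κ₁.layer m))).ncard) ≤ Module.finrank ℚ K * ((q ^ (p - 1) - 1) * (p - 1)) := by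
  haveI : FiniteDimensional K ↥(κ₁.layer m) := κ₁.finiteDimensional_layer_holds m
  haveI : NumberField ↥(κ₁.layer m) := NumberField.of_module_finite K _
  set L : IntermediateField ℚ (AlgebraicClosure ℚ) := κ.layer (m + a) with hL
  haveI : FiniteDimensional ℚ ↥L := κ.finiteDimensional_layer_holds (m + a)
  haveI : NumberField ↥L := NumberField.of_module_finite ℚ _
  set j : K →ₐ[ℚ] AlgebraicClosure ℚ := absEmbedding ℚ K with hj
  haveI : NumberField ↥(j.fieldRange ⊔ L) := numberField_fieldRange_sup_layer κ K j (m + a)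
  haveI : FiniteDimensional ℚ ↥j.fieldRange := (AlgEquiv.ofInjectiveField j).toLinearEquiv.finiteDimensional
  letI : Algebra ↥L ↥(j.fieldRange ⊔ L) := (IntermediateField.inclusion (le_sup_right : L ≤ j.fieldRange ⊔ L)).toRingHom.toAlgebra
  haveI : IsScalarTower ℚ ↥L ↥(j.fieldRange ⊔ L) := IsScalarTower.of_algebraMap_eq fun _ ↦ rfl
  haveI : Module.Free ↥L ↥(j.fieldRange ⊔ L) := Module.Free.of_divisionRing _ _
  haveI : FiniteDimensional ↥L ↥(j.fieldRange ⊔ L) := Module.Finite.of_restrictScalars_finite ℚ _ _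
  obtain ⟨e⟩ := nonempty_ringEquiv_layer_fieldRange_sup_layer_of_layerSubgroup_eq κ K κ₁
    (layerSubgroup_eq_comap_of_shift κ K κ₁ hs m) j
  rw [ncard_primesOver_eq_of_ringEquiv e q]
  have hdegLA : Module.finrank ↥L ↥(j.fieldRange ⊔ L) ≤ Module.finrank ℚ K := by
    have htower := Module.finrank_mul_finrank ℚ ↥L ↥(j.fieldRange ⊔ L)
    have hsup : Module.finrank ℚ ↥(j.fieldRange ⊔ L) ≤ Module.finrank ℚ ↥j.fieldRange * Module.finrank ℚ ↥L :=
      IntermediateField.finrank_sup_le j.fieldRange L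
    have hjK : Module.finrank ℚ ↥j.fieldRange = Module.finrank ℚ K :=
      (AlgEquiv.ofInjectiveField j).toLinearEquiv.finrank_eq.symm
    have hLpos : 0 < Module.finrank ℚ ↥L := Module.finrank_pos
    rw [hjK, ← htower, mul_comm (Module.finrank ℚ K)] at hsup
    exact Nat.le_of_mul_le_mul_left hsup hLpos
  calc ((Ideal.span {(q : ℤ)}).primesOver (𝓞 ↥(j.fieldRange ⊔ L))).ncard
      ≤ Module.finrank ↥L ↥(j.fieldRange ⊔ L) * ((Ideal.span {(q : ℤ)}).primesOver (𝓞 ↥L)).ncard :=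
        ncard_primesOver_le_finrank_mul ↥L ↥(j.fieldRange ⊔ L) hq
    _ ≤ Module.finrank ℚ K * ((q ^ (p - 1) - 1) * (p - 1)) :=
        Nat.mul_le_mul hdegLA (ncard_primesOver_layer_le_odd hodd hκ (m + a) hq)

/-! ## §3 The per-layer bound for `A_m = K_m ⊆ B_m = j''(K')·K_m`, every `m` -/

/-- The rational prime under a maximal ideal of a ring of integers. [folklore] -/
private theorem exists_ratPrime_liesOver₅ {L : Type*} [Field L] [NumberField L] (P : Ideal (𝓞 L)) [P.IsMaximal] :
    ∃ q : ℕ, q.Prime ∧ P.LiesOver (Ideal.span {(q : ℤ)}) := by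
  have hP0 : P ≠ ⊥ := Ring.ne_bot_of_isMaximal_of_not_isField ‹_› (RingOfIntegers.not_isField L)
  haveI : (P.under ℤ).IsPrime := Ideal.IsPrime.under ℤ P
  have hPZ0 : P.under ℤ ≠ ⊥ := mt Ideal.eq_bot_of_comap_eq_bot hP0
  set g := Submodule.IsPrincipal.generator (P.under ℤ) with hgdef
  have hg : Ideal.span {g} = P.under ℤ := Ideal.span_singleton_generator (P.under ℤ)
  have hg0 : g ≠ 0 := fun h => hPZ0 (by rw [← hg, h, Ideal.span_singleton_eq_bot])
  have hgprime : Prime g := (Ideal.span_singleton_prime hg0).mp (hg.symm ▸ inferInstance)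
  refine ⟨g.natAbs, Int.prime_iff_natAbs_prime.mp hgprime, ⟨?_⟩⟩
  rw [Int.span_natAbs, hg]

set_option maxHeartbeats 800000 in
set_option synthInstance.maxHeartbeats 200000 in
/-- ★★ **The per-layer `p`-rank bound, no surjectivity anywhere** (`p` odd).  `κ` a cyclotomic `ℤ_p`-extension of `ℚ`; `K ⊆ K'` number fields with
`K'/K` GALOIS OF DEGREE `p`; `κ₁` a `ℤ_p`-extension of `K` with `p^a κ₁ = κ ∘ res` (the shifted base change — cyclotomic; layers `K_m`);
`j'' : K' → K̄` over `K`.  Then for EVERY `m`, with `A_m = K_m ⊆ B_m = j''(K')·K_m`: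
`rank_p Cl(B_m) ≤ p·(2·rank_p Cl(A_m) + [K:ℚ]·∑_{q ∣ disc K'} (q^{p−1}−1)(p−1))`.  `B_m/A_m` is Galois with group embedding into `Gal(K'/K) ≅ C_p`
by restriction, so `[B_m : A_m] ∈ {1, p}`; degree `1`: `B_m = A_m`; degree `p`: §1 with the ramified primes of `A_m` above the prime factors of
`disc K'` (relative base change `isUnramifiedIn_of_isUnramifiedIn_relative`), counted by §2.
[cite: Iwasawa1973MuInvariants, Thm. 2 (ℓ odd) and §2] [cite: Washington1997, §13.1 and §13.3 Prop. 13.23]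
[cite: NeukirchANT1999, Ch. III §2 Cor. (2.12)] [cite: Marcus2018, Ch. 4 Thm. 31] -/
theorem padicValNat_card_quotient_fieldRange_sup_layer_le_odd (hodd : p ≠ 2) {κ : ZpExtension ℚ p} (hκ : κ.IsCyclotomic)
    (K K' : Type) [Field K] [NumberField K] [Field K'] [NumberField K'] [Algebra K K'] [IsGalois K K']
    (hdeg : Module.finrank K K' = p) (κ₁ : ZpExtension K p) {a : ℕ}
    (hs : ∀ σ : absoluteGaloisGroup K, (p : ℤ_[p]) ^ a * (κ₁ σ).toAdd = (κ (absGaloisRestrict ℚ K σ)).toAdd)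
    (j'' : K' →ₐ[K] AlgebraicClosure K) (m : ℕ) :
    haveI : FiniteDimensional K K' := Module.Finite.of_restrictScalars_finite ℚ K K'
    padicValNat p (Nat.card (ClassGroup (𝓞 ↥(j''.fieldRange ⊔ κ₁.layer m)) ⧸
        (powMonoidHom p : ClassGroup (𝓞 ↥(j''.fieldRange ⊔ κ₁.layer m)) →* _).range)) ≤
      p * (2 * classGroupPRank κ₁ m +
        Module.finrank ℚ K * ∑ q ∈ (NumberField.discr K').natAbs.primeFactors, (q ^ (p - 1) - 1) * (p - 1)) := by
  classical
  have hpp : p.Prime := hp.out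
  haveI : FiniteDimensional K K' := Module.Finite.of_restrictScalars_finite ℚ K K'
  set T : ℕ := Module.finrank ℚ K * ∑ q ∈ (NumberField.discr K').natAbs.primeFactors, (q ^ (p - 1) - 1) * (p - 1) with hT
  -- the layers `A = K_m ⊆ B = j''(K')·K_m`
  set A : IntermediateField K (AlgebraicClosure K) := κ₁.layer m with hA
  set B : IntermediateField K (AlgebraicClosure K) := j''.fieldRange ⊔ κ₁.layer m with hB
  have hAB : A ≤ B := le_sup_right
  haveI : FiniteDimensional K ↥A := κ₁.finiteDimensional_layer_holds m
  haveI : NumberField ↥A := NumberField.of_module_finite K ↥A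
  haveI : NumberField ↥B := numberField_fieldRange_sup_layer κ₁ K' j'' m
  haveI : FiniteDimensional K ↥j''.fieldRange := (AlgEquiv.ofInjectiveField j'').toLinearEquiv.finiteDimensional
  haveI : FiniteDimensional K ↥B := IntermediateField.finiteDimensional_sup _ _
  letI algL : Algebra ↥A ↥B := (IntermediateField.inclusion hAB).toRingHom.toAlgebra
  haveI : IsScalarTower K ↥A ↥B := IsScalarTower.of_algebraMap_eq fun _ ↦ rfl
  haveI : Module.Free ↥A ↥B := Module.Free.of_divisionRing ↥A ↥B
  haveI : FiniteDimensional ↥A ↥B := Module.Finite.of_restrictScalars_finite K ↥A ↥B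
  haveI : IsGalois ↥A ↥B := isGalois_layer_fieldRange_sup_layer κ₁ K' j'' m
  -- `K' → B` compatibly
  let eK : K' →+* ↥B :=
    (j'' : K' →+* AlgebraicClosure K).codRestrict B fun x =>
      (le_sup_left : j''.fieldRange ≤ B) (j''.mem_fieldRange.mpr ⟨x, rfl⟩)
  letI algK : Algebra K' ↥B := eK.toAlgebra
  haveI : IsScalarTower K K' ↥B := IsScalarTower.of_algebraMap_eq fun x => Subtype.ext (j''.commutes x).symm
  -- `[B : A] ≤ p`
  have hdegle : Module.finrank ↥A ↥B ≤ p := by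
    have htower := Module.finrank_mul_finrank K ↥A ↥B
    have hsup : Module.finrank K ↥B ≤ Module.finrank K ↥j''.fieldRange * Module.finrank K ↥A :=
      IntermediateField.finrank_sup_le j''.fieldRange (κ₁.layer m)
    have hjK : Module.finrank K ↥j''.fieldRange = p := by
      rw [← hdeg]; exact (AlgEquiv.ofInjectiveField j'').toLinearEquiv.finrank_eq.symm
    have hApos : 0 < Module.finrank K ↥A := Module.finrank_pos
    rw [hjK, ← htower, mul_comm p] at hsup
    exact Nat.le_of_mul_le_mul_left hsup hApos
  -- the restriction `Gal(B/A) → Gal(K'/K)` is injective, so `[B : A] ∣ p`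
  let r : (↥B ≃ₐ[↥A] ↥B) →* (K' ≃ₐ[K] K') :=
    { toFun := fun σ => AlgEquiv.restrictNormalHom K' (σ.restrictScalars K)
      map_one' := by
        have h1 : ((1 : ↥B ≃ₐ[↥A] ↥B).restrictScalars K : ↥B ≃ₐ[K] ↥B) = 1 := AlgEquiv.ext fun _ => rfl
        rw [h1, map_one]
      map_mul' := fun σ τ => by
        have h1 : ((σ * τ).restrictScalars K : ↥B ≃ₐ[K] ↥B) = σ.restrictScalars K * τ.restrictScalars K :=
          AlgEquiv.ext fun _ => rfl
        rw [h1, map_mul] }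
  have hr : ∀ (σ : ↥B ≃ₐ[↥A] ↥B) (x : K'), algebraMap K' ↥B (r σ x) = σ (algebraMap K' ↥B x) :=
    fun σ x => AlgEquiv.restrictNormal_commutes (σ.restrictScalars K) K' x
  have hrinj : Function.Injective r := by
    intro σ τ hστ
    rw [← mul_inv_eq_one]
    set ρ := σ * τ⁻¹ with hρ
    have hρ1 : r ρ = 1 := by rw [hρ, map_mul, map_inv, hστ, mul_inv_cancel]
    -- `ρ` fixes `j''(K')` and `A = K_m`, hence `B = j''(K') ⊔ K_m`
    have key : (ρ : ↥B ≃ₐ[↥A] ↥B).toRingEquiv.toRingHom = RingHom.id ↥B := by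
      refine ringHom_ext_of_sup j''.fieldRange (κ₁.layer m) _ _ (fun x hx ↦ ?_) (fun x hx ↦ ?_)
      · obtain ⟨y, rfl⟩ := hx
        have h := hr ρ y
        rw [hρ1, AlgEquiv.one_apply] at h
        -- `algebraMap K' B y = ⟨j'' y, _⟩`
        have e1 : (algebraMap K' ↥B y : ↥B) = ⟨j'' y, (le_sup_left : j''.fieldRange ≤ B) ⟨y, rfl⟩⟩ := rfl
        rw [e1] at h
        exact h.symm
      · exact ρ.commutes ⟨x, hx⟩
    apply AlgEquiv.ext
    intro b
    have := RingHom.congr_fun key b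
    exact this
  have hdvd : Nat.card (↥B ≃ₐ[↥A] ↥B) ∣ p := by
    have h1 : Nat.card (↥B ≃ₐ[↥A] ↥B) = Nat.card r.range := (Nat.card_congr (Equiv.ofInjective r hrinj)).trans (by rfl)
    rw [h1, ← show Nat.card (K' ≃ₐ[K] K') = p by rw [IsGalois.card_aut_eq_finrank, hdeg]]
    exact Subgroup.card_subgroup_dvd_card r.range
  have hcardAB : Nat.card (↥B ≃ₐ[↥A] ↥B) = Module.finrank ↥A ↥B := IsGalois.card_aut_eq_finrank ↥A ↥B
  -- abbreviations for the two ranks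
  set rB : ℕ := padicValNat p (Nat.card (ClassGroup (𝓞 ↥B) ⧸ (powMonoidHom p : ClassGroup (𝓞 ↥B) →* _).range)) with hrB
  have hrA : classGroupPRank κ₁ m = padicValNat p (Nat.card (ClassGroup (𝓞 ↥A) ⧸ (powMonoidHom p : ClassGroup (𝓞 ↥A) →* _).range)) :=
    classGroupPRank_def κ₁ m
  change rB ≤ p * (2 * classGroupPRank κ₁ m + T)
  rcases (Nat.dvd_prime hpp).mp (hcardAB ▸ hdvd) with h1 | hP
  · -- degree `1`: `B = A`
    have hfin : Module.finrank K ↥A = Module.finrank K ↥B := by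
      have htower := Module.finrank_mul_finrank K ↥A ↥B
      rw [h1, mul_one] at htower
      exact htower
    have hEq : A = B := IntermediateField.eq_of_le_of_finrank_eq hAB hfin
    have hrAB : classGroupPRank κ₁ m = rB := by
      rw [hrA, hrB]
      exact congrArg (padicValNat p) (natCard_quotient_range_powMonoidHom_eq_of_mulEquiv₅
        (ClassGroup.mulEquiv (NumberField.RingOfIntegers.mapRingEquiv (IntermediateField.equivOfEq hEq).toRingEquiv)) p)
    have hp1 : 1 ≤ p := hpp.one_lt.le
    nlinarith
  · -- degree `p`: Chevalley
    have hdegAB : Module.finrank ↥A ↥B = p := hP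
    haveI : IsGaloisGroup (↥B ≃ₐ[↥A] ↥B) (𝓞 ↥A) (𝓞 ↥B) := IsGaloisGroup.of_isFractionRing _ _ _ ↥A ↥B
    -- `B` is generated over `A` by the image of `K'` (prime degree)
    have hgen : IntermediateField.adjoin ↥A (Set.range (algebraMap K' ↥B)) = ⊤ := by
      set E := IntermediateField.adjoin ↥A (Set.range (algebraMap K' ↥B)) with hE
      have h2 : (Module.finrank ↥A ↥B).Prime := by rw [hdegAB]; exact hpp
      haveI := IntermediateField.isSimpleOrder_of_finrank_prime ↥A ↥B h2
      rcases eq_bot_or_eq_top E with h | h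
      · exfalso
        have hsub : j''.fieldRange ≤ κ₁.layer m := by
          rintro _ ⟨x, rfl⟩
          have hx : algebraMap K' ↥B x ∈ (⊥ : IntermediateField ↥A ↥B) := h ▸ IntermediateField.subset_adjoin _ _ ⟨x, rfl⟩
          obtain ⟨y, hy⟩ := IntermediateField.mem_bot.mp hx
          have hy' : ((y : ↥A) : AlgebraicClosure K) = j'' x := congrArg (fun z : ↥B => (z : AlgebraicClosure K)) hy
          exact hy' ▸ y.2
        have heq : j''.fieldRange ⊔ κ₁.layer m = κ₁.layer m := sup_eq_right.mpr hsub
        have hfin : Module.finrank K ↥B = Module.finrank K ↥A := (IntermediateField.equivOfEq heq).toLinearEquiv.finrank_eq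
        have htower := Module.finrank_mul_finrank K ↥A ↥B
        rw [hfin, hdegAB] at htower
        have : Module.finrank K ↥A * p = Module.finrank K ↥A * 1 := by rw [htower, mul_one]
        exact hpp.one_lt.ne' (Nat.eq_of_mul_eq_mul_left Module.finrank_pos this)
      · exact h
    -- every ramified prime of `A` lies over a prime factor of `disc K'`
    set P := (NumberField.discr K').natAbs.primeFactors with hPdef
    have hdisc : NumberField.discr K' ≠ 0 := NumberField.discr_ne_zero K'
    have hcover : {w : HeightOneSpectrum (𝓞 ↥A) | w.asIdeal.ramificationIdxIn (𝓞 ↥B) ≠ 1} ⊆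
        ⋃ q ∈ P, {w : HeightOneSpectrum (𝓞 ↥A) | w.asIdeal ∈ (Ideal.span {(q : ℤ)}).primesOver (𝓞 ↥A)} := by
      intro w hw
      haveI := w.isPrime
      obtain ⟨⟨Q, hQ, hQw⟩⟩ := w.asIdeal.nonempty_primesOver (S := 𝓞 ↥B)
      haveI := hQ; haveI := hQw
      have hnot : ¬ Algebra.IsUnramifiedIn (𝓞 ↥B) w.asIdeal := fun hunr =>
        hw ((Ideal.ramificationIdxIn_eq_ramificationIdx w.asIdeal Q (↥B ≃ₐ[↥A] ↥B)).trans (hunr.ramificationIdx_eq_one hQw))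
      haveI : w.asIdeal.IsMaximal := w.isPrime.isMaximal w.ne_bot
      obtain ⟨q, hq, hwq⟩ := exists_ratPrime_liesOver₅ w.asIdeal
      haveI := hwq; haveI : Fact q.Prime := ⟨hq⟩
      set v : Ideal (𝓞 K) := w.asIdeal.under (𝓞 K) with hvdef
      haveI : v.IsPrime := Ideal.IsPrime.under _ w.asIdeal
      have hwv : w.asIdeal.LiesOver v := ⟨rfl⟩
      haveI := hwv
      haveI hvq : v.LiesOver (Ideal.span {(q : ℤ)}) := Ideal.LiesOver.tower_bot w.asIdeal v (Ideal.span {(q : ℤ)})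
      -- `v` ramifies in `K'` (relative base change)
      have hKv : ¬ Algebra.IsUnramifiedIn (𝓞 K') v := fun hunr =>
        hnot (isUnramifiedIn_of_isUnramifiedIn_relative (K := K) (K' := K') hgen hunr w hwv)
      -- hence `q` ramifies in `K'/ℚ`
      have hqK : ¬ Algebra.IsUnramifiedIn (𝓞 K') (Ideal.span {(q : ℤ)}) := by
        intro hq_unr
        apply hKv
        rw [Algebra.isUnramifiedIn_iff_forall_ramificationIdx_eq_one]
        intro P' _ hP'v
        haveI := hP'v
        have hP'q : P'.LiesOver (Ideal.span {(q : ℤ)}) := Ideal.LiesOver.trans P' v (Ideal.span {(q : ℤ)})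
        have h1 : P'.ramificationIdx ℤ = 1 := hq_unr.ramificationIdx_eq_one hP'q
        have hdvd' : P'.ramificationIdx (𝓞 K) ∣ P'.ramificationIdx ℤ := Ideal.ramificationIdx_above_dvd v P'
        rw [h1] at hdvd'
        exact Nat.dvd_one.mp hdvd'
      have hqd : (q : ℤ) ∣ NumberField.discr K' := by
        by_contra hnd
        exact hqK ((NumberField.not_dvd_discr_iff_isUnramifiedIn K' (𝓞 K') (Nat.prime_iff_prime_int.mp hq)).mp hnd)
      refine Set.mem_biUnion (x := q) ?_ ?_
      · exact Nat.mem_primeFactors.mpr ⟨hq, Int.natAbs_dvd_natAbs.mpr hqd |>.trans (by simp), Int.natAbs_ne_zero.mpr hdisc⟩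
      · exact ⟨w.isPrime, hwq⟩
    have hfin : ∀ q ∈ P,
        ({w : HeightOneSpectrum (𝓞 ↥A) | w.asIdeal ∈ (Ideal.span {(q : ℤ)}).primesOver (𝓞 ↥A)}).Finite ∧
        ({w : HeightOneSpectrum (𝓞 ↥A) | w.asIdeal ∈ (Ideal.span {(q : ℤ)}).primesOver (𝓞 ↥A)}).ncard ≤
          Module.finrank ℚ K * ((q ^ (p - 1) - 1) * (p - 1)) := by
      intro q hq
      have hqp : q.Prime := Nat.prime_of_mem_primeFactors hq
      haveI : Fact q.Prime := ⟨hqp⟩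
      haveI : (Ideal.span {(q : ℤ)}).IsMaximal := Int.ideal_span_isMaximal_of_prime q
      have hinj : Set.InjOn (fun w : HeightOneSpectrum (𝓞 ↥A) => w.asIdeal)
          {w | w.asIdeal ∈ (Ideal.span {(q : ℤ)}).primesOver (𝓞 ↥A)} := fun w _ w' _ h => HeightOneSpectrum.ext h
      have hmaps : Set.MapsTo (fun w : HeightOneSpectrum (𝓞 ↥A) => w.asIdeal)
          {w | w.asIdeal ∈ (Ideal.span {(q : ℤ)}).primesOver (𝓞 ↥A)} ((Ideal.span {(q : ℤ)}).primesOver (𝓞 ↥A)) := fun w hw => hw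
      have hfinT : ((Ideal.span {(q : ℤ)}).primesOver (𝓞 ↥A)).Finite := IsDedekindDomain.primesOver_finite _ _
      refine ⟨Set.Finite.of_injOn hmaps hinj hfinT, ?_⟩
      calc ({w : HeightOneSpectrum (𝓞 ↥A) | w.asIdeal ∈ (Ideal.span {(q : ℤ)}).primesOver (𝓞 ↥A)}).ncard
          ≤ ((Ideal.span {(q : ℤ)}).primesOver (𝓞 ↥A)).ncard := Set.ncard_le_ncard_of_injOn _ hmaps hinj hfinT
        _ ≤ Module.finrank ℚ K * ((q ^ (p - 1) - 1) * (p - 1)) := ncard_primesOver_layer_shift_le_odd hodd hκ K κ₁ hs m hqp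
    have hramT : {w : HeightOneSpectrum (𝓞 ↥A) | w.asIdeal.ramificationIdxIn (𝓞 ↥B) ≠ 1}.ncard ≤ T :=
      calc {w : HeightOneSpectrum (𝓞 ↥A) | w.asIdeal.ramificationIdxIn (𝓞 ↥B) ≠ 1}.ncard
          ≤ (⋃ q ∈ P, {w : HeightOneSpectrum (𝓞 ↥A) | w.asIdeal ∈ (Ideal.span {(q : ℤ)}).primesOver (𝓞 ↥A)}).ncard :=
            Set.ncard_le_ncard hcover (Set.Finite.biUnion P.finite_toSet fun q hq => (hfin q hq).1)
        _ ≤ ∑ q ∈ P, ({w : HeightOneSpectrum (𝓞 ↥A) | w.asIdeal ∈ (Ideal.span {(q : ℤ)}).primesOver (𝓞 ↥A)}).ncard :=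
            Finset.set_ncard_biUnion_le P _
        _ ≤ ∑ q ∈ P, Module.finrank ℚ K * ((q ^ (p - 1) - 1) * (p - 1)) := Finset.sum_le_sum fun q hq => (hfin q hq).2
        _ = T := by rw [hT, Finset.mul_sum]
    rw [hrA]
    exact padicValNat_card_quotient_le_of_cyclic_odd hodd ↥A ↥B hdegAB T hramT

end Literature.NumberTheory.IwasawaTheory

end
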